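import Summits.QuantumFields.YangMills.Theorems.BalabanUVNodesN15TwoSpacingGluingCurvedCoverRows
import Summits.QuantumFields.YangMills.Theorems.BalabanUVNodesN15NeumannCubeTailRowColour
import Summits.QuantumFields.YangMills.Theorems.BalabanUVNodesN15CurvedGluingSmoothCutDressedGluedGaugedUN
import HarnessLib

/-!
# THE GLUING STEP AT TWO LATTICE SPACINGS — (Γ15) THE LIVE-`U` KNIT AT THE COVER, II: THE COVER ROWS `⊗ 1_ι` ON dag-n15-w3's COLOURED CARRIER `(Tor (fine n M) × Fin (d+1)) × ι`
# (dictionary `Σ∇̂*∇̂ = (Σ∇*∇) ⊗ 1`, `[N ⊗ 1, M_{h∘fst}] = [N, M_h] ⊗ 1`; the cut rows, the plateau identity, the exact locality, the tail and the commutator row of FILE 117 ∕ FILES 66–72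
# lifted componentwise in the colour index) (dag-n15-c g15, FILE 118; N15 = NE2, s1 «background-layer OPERATOR ingredient»)

Cell `pub-ymgap`, seat `pub-ymgap-dag-n15-c` (R134 (a); HUMAN RULING D-0062), generation 15.  `bears_on: R4∕N15 · K3⁸ SpineGivenEndpointR13SepCoPHV (stmt-QuantumFields-27366)`.
Filed `--kind proof --supports stmt-QuantumFields-27366 --as helper` — COUNT-NEUTRAL.  Theorems only; 0 `def`, 0 `sorry`.  Imports BY NAME FILE 117 `…CurvedCoverRows` (the scalar rows),
dag-n15-a N-IIv `…NeumannCubeTailRowColour` (`tensorId_mulOp`, `mulOp_fst_comp_tensorId`, `tensorId_comp_mulOp_fst`, `tail_tensorId_eq`; through it `tensorId`, `hasMaj_tensorId`) and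
dag-n15-w3 52 `…SmoothCutDressedGluedGaugedUN` (for the vocabulary `lapOp` on lifted shifts, `fgrad_liftEquiv_comp`, `bgrad_liftEquiv_comp`, `tensorId_add`∕`_sum`∕`_comp_tensorId`;
FILE 119 calls its two capstones).  Nothing in the tree is modified, no landed name re-declared.

WHY.  dag-n15-w3's dressed smooth-cut cubes (files 44∕45∕47∕48∕52∕53) live on the product carrier `X × ι` with `ι` the colour (Lie-algebra coordinate) index: the FLAT cube operator
`N_k`, the flat nonlocal part `N_L` and every multiplier act componentwise.  At the cover `X = Tor (fine n M) × Fin (d+1)`, `N_k := G(□_k) ⊗ 1_ι = tensorId ι (neumannCubeG …)`,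
`N_L := (aQ*Q − ∂Π∂*) ⊗ 1_ι`; THIS FILE turns the scalar rows of FILE 117 (and FILES 66∕69∕72) into the LITERAL hypothesis shapes of 52:
* §1 dictionary (generic carrier): `fgrad_liftEquiv_eq`∕`fgradAdj_liftEquiv_eq`∕`bgrad_liftEquiv_eq` (`∇̂ = ∇ ⊗ 1`), ★ `lapOp_liftEquiv_eq` (`Σ_μ∇̂*_μ∇̂_μ + 0 = (Σ_μ∇*_μ∇_μ + 0) ⊗ 1`),
  ★ `commOp_tensorId_fst` (`[T ⊗ 1, M_{h∘fst}] = [T, M_h] ⊗ 1`), `mulOp_one_sub_fst`, and the transfer lemmas `hasMaj_mulOp_fst_tensorId` (cut row), `hasMaj_mulOp_fst_fgrad_tensorId` ∕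
  `hasMaj_mulOp_fst_bgrad_tensorId` (gradient cut rows), `tensorId_comp_mulOp_fst_of` (plateau), `mulOp_fst_lapOp_add_tensorId_of` (exact locality);
* §2 the cover rows lifted (torus `M_ν = 2qw`, cube `□_k` of side `qw`, inner cut box `c(m₁,k) + [0,S₁)`, partition `h_k`, radius-2 bump `χ̃_k`; torus letters `G ≤ Ce^{−δ₀d}`,
  `∇_νG ≤ Ce^{−δ₀d}`, `∂Π∂* ≤ C₁e^{−δ₁d}` displayed): ★★ `hasMaj_cut_cover_lift` (52's `hcut`), ★★ `hasMaj_cutF_cover_lift` ∕ `hasMaj_cutB_cover_lift` (`hcutF`∕`hcutB`, weight `c = n`),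
  ★ `cube_comp_psi_cover_lift` (`hNψ`), ★★ `loc0_cover_lift` (`hloc0`), ★★★ `hasMaj_tail_cover_lift` (`hT`), ★★ `hasMaj_commOp_nonlocal_cover_lift` (`hKN`).

HONEST FRAMING ∕ LIMITS.  Componentwise-lift bookkeeping over LANDED rows; no new analytic estimate; `U ≡ 1` doubled-cube torus MODEL cubes (the live `U` enters only in FILE 119 through
dag-n15-w3's dressed cubes); nothing of [B5]∕[B6]∕[B9] asserted ((2.36)–(2.37) p.229, (2.91)–(2.93) p.239, (2.133)–(2.136) p.247, (2.156) p.250, (3.62)–(3.65) pp.402–403 = SHAPES ∕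
MECHANISM).  NE2⁺ NOT PRINTED, NOT proved; N15 NOT discharged; K3⁸ OPEN, skeleton v6 untouched; counts of record UNMOVED (typed 28∕28 · discharged 5∕27); one finite 𝕋⁴ at fixed ε —
NOT infinite volume, NOT OS on ℝ⁴, NOT a mass gap, NOT Clay; R4 closes the conditional finite-𝕋⁴ rung `BalabanLadder.UV` only.  Restate-immune (no Theses import).
-/

noncomputable section

namespace Summit.QuantumFields.YangMills.BalabanUVNodes.N15.Gluing

open Real
open Literature.MathematicalPhysics.QuantumFieldTheory.Balaban1983to89
open Literature.MathematicalPhysics.QuantumFieldTheory.Balaban1983to89.B5Prop11Plancherel (Tor fine unitVec)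
open Literature.MathematicalPhysics.QuantumFieldTheory.Balaban1983to89.B11SectG (BlockNorm HasMaj RowSum)
open Literature.MathematicalPhysics.QuantumFieldTheory.Balaban1983to89.B6RandomWalk (Triangle254)
open Literature.MathematicalPhysics.QuantumFieldTheory.Balaban1983to89.B6Prop26Gluing (mulOp mulOp_apply ind ind_nonneg ind_le_one)
open Literature.MathematicalPhysics.QuantumFieldTheory.Balaban1983to89.B6UnitTorusCarrier (unitTorusGeo)
open Literature.MathematicalPhysics.QuantumFieldTheory.King1986.Torus (blockOf tdistT tdistT_nonneg)
open Summit.QuantumFields.YangMills.BalabanUVNodes.N15.BackgroundLayer (fgrad fgradAdj bgrad fgrad_apply fgradAdj_apply bgrad_apply fgrad_liftEquiv_comp bgrad_liftEquiv_comp tensorId_add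
  tensorId_sum tensorId_comp_tensorId tensorId_sub)
open Summit.QuantumFields.YangMills.BalabanUVNodes.N15.VectorPiece (bshiftEquiv bshiftEquiv_apply tensorId tensorId_apply hasMaj_tensorId)
open Summit.QuantumFields.YangMills.BalabanUVNodes.N15.MatrixSpecies (liftBlk liftEquiv liftEquiv_apply liftEquiv_symm_apply)
open Summit.QuantumFields.YangMills.BalabanUVNodes.N15.TwoGrid (symbOp sD landauRe qvRe qvAdjRe gOp neumannCubeG chiCube cubeBlocks tensorId_mulOp mulOp_fst_comp_tensorId tensorId_comp_mulOp_fst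
  tail_tensorId_eq)

variable {d : ℕ}

/-! ## §1 The componentwise-lift dictionary -/

section Dictionary

variable {X X₂ : Type} (ι : Type) {J : Type} [Fintype J]

omit [Fintype J] in
/-- `∇̂_s = ∇_s ⊗ 1_ι` for the lifted shift `liftEquiv s ι`. [folklore] -/
theorem fgrad_liftEquiv_eq (c : ℝ) (s : X ≃ X) : fgrad c (liftEquiv s ι) = tensorId ι (fgrad c s) :=
  LinearMap.ext fun f => funext fun p => by simp only [fgrad_apply, tensorId_apply, liftEquiv_apply]

omit [Fintype J] in
/-- `∇̂*_s = ∇*_s ⊗ 1_ι`. [folklore] -/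
theorem fgradAdj_liftEquiv_eq (c : ℝ) (s : X ≃ X) : fgradAdj c (liftEquiv s ι) = tensorId ι (fgradAdj c s) :=
  LinearMap.ext fun f => funext fun p => by simp only [fgradAdj_apply, tensorId_apply, liftEquiv_symm_apply]

omit [Fintype J] in
/-- `∇̂⁻_s = ∇⁻_s ⊗ 1_ι`. [folklore] -/
theorem bgrad_liftEquiv_eq (c : ℝ) (s : X ≃ X) : bgrad c (liftEquiv s ι) = tensorId ι (bgrad c s) :=
  LinearMap.ext fun f => funext fun p => by simp only [bgrad_apply, tensorId_apply, liftEquiv_symm_apply]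

/-- ★ **THE FLAT LAPLACIAN ON THE COLOURED CARRIER IS THE LIFT OF THE FLAT LAPLACIAN**: `lapOp c (liftEquiv ∘ e) 0 = (lapOp c e 0) ⊗ 1_ι`. [cite: Balaban1984PropagatorsII, (2.156) p.250 (the `U ≡ 1` operator on `𝔤`-valued forms acts diagonally in the colour: shape)] -/
theorem lapOp_liftEquiv_eq (c : ℝ) (e : J → X ≃ X) :
    lapOp c (fun μ => liftEquiv (e μ) ι) (0 : (X × ι → ℝ) →ₗ[ℝ] (X × ι → ℝ)) = tensorId ι (lapOp c e 0) := by
  simp only [lapOp, lapDir, add_zero, tensorId_sum, fgrad_liftEquiv_eq, fgradAdj_liftEquiv_eq, tensorId_comp_tensorId]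

omit [Fintype J] in
/-- ★ `[T ⊗ 1, M_{h∘fst}] = [T, M_h] ⊗ 1`. [folklore] -/
theorem commOp_tensorId_fst (T : (X → ℝ) →ₗ[ℝ] (X → ℝ)) (h : X → ℝ) : commOp (tensorId ι T) (fun p : X × ι => h p.1) = tensorId ι (commOp T h) := by
  simp only [commOp, tensorId_comp_mulOp_fst, mulOp_fst_comp_tensorId, tensorId_sub]

omit [Fintype J] in
/-- `M_{1 − f∘fst} = M_{(1−f)∘fst}` (syntactic bridge for the tail's collar). [folklore] -/
theorem mulOp_one_sub_fst (f : X → ℝ) : mulOp (1 - fun p : X × ι => f p.1) = mulOp (fun p : X × ι => (1 - f) p.1) := rfl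

variable [Fintype X] [Fintype ι] {g : B6.Geometry} {blk : X → g.Site}

omit [Fintype J] in
/-- ★ **A CUT ROW LIFTS**: `M_χ∘T ≤ K` (`K ≥ 0`) ⟹ `M_{χ∘fst}∘(T ⊗ 1) ≤ K` on the lifted block norms. [folklore] -/
theorem hasMaj_mulOp_fst_tensorId {χ : X → ℝ} {T : (X → ℝ) →ₗ[ℝ] (X → ℝ)} {K : g.Site → g.Site → ℝ} (hK : ∀ y y', 0 ≤ K y y')
    (h : HasMaj (BlockNorm.ofBlocks g blk) (BlockNorm.ofBlocks g blk) (mulOp χ ∘ₗ T) K) :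
    HasMaj (BlockNorm.ofBlocks g (liftBlk blk ι)) (BlockNorm.ofBlocks g (liftBlk blk ι)) (mulOp (fun p : X × ι => χ p.1) ∘ₗ tensorId ι T) K := by
  rw [mulOp_fst_comp_tensorId]
  exact hasMaj_tensorId ι hK h

omit [Fintype J] in
/-- ★ **A FORWARD-GRADIENT CUT ROW LIFTS**: `M_χ∘∇_s∘T ≤ K` ⟹ `M_{χ∘fst}∘∇̂_s∘(T ⊗ 1) ≤ K`. [folklore] -/
theorem hasMaj_mulOp_fst_fgrad_tensorId {χ : X → ℝ} {T : (X → ℝ) →ₗ[ℝ] (X → ℝ)} {K : g.Site → g.Site → ℝ} (hK : ∀ y y', 0 ≤ K y y') (c : ℝ) (s : X ≃ X)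
    (h : HasMaj (BlockNorm.ofBlocks g blk) (BlockNorm.ofBlocks g blk) (mulOp χ ∘ₗ (fgrad c s ∘ₗ T)) K) :
    HasMaj (BlockNorm.ofBlocks g (liftBlk blk ι)) (BlockNorm.ofBlocks g (liftBlk blk ι)) (mulOp (fun p : X × ι => χ p.1) ∘ₗ (fgrad c (liftEquiv s ι) ∘ₗ tensorId ι T)) K := by
  rw [fgrad_liftEquiv_comp, mulOp_fst_comp_tensorId]
  exact hasMaj_tensorId ι hK h

omit [Fintype J] in
/-- ★ **A BACKWARD-GRADIENT CUT ROW LIFTS**: `M_χ∘∇⁻_s∘T ≤ K` ⟹ `M_{χ∘fst}∘∇̂⁻_s∘(T ⊗ 1) ≤ K`. [folklore] -/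
theorem hasMaj_mulOp_fst_bgrad_tensorId {χ : X → ℝ} {T : (X → ℝ) →ₗ[ℝ] (X → ℝ)} {K : g.Site → g.Site → ℝ} (hK : ∀ y y', 0 ≤ K y y') (c : ℝ) (s : X ≃ X)
    (h : HasMaj (BlockNorm.ofBlocks g blk) (BlockNorm.ofBlocks g blk) (mulOp χ ∘ₗ (bgrad c s ∘ₗ T)) K) :
    HasMaj (BlockNorm.ofBlocks g (liftBlk blk ι)) (BlockNorm.ofBlocks g (liftBlk blk ι)) (mulOp (fun p : X × ι => χ p.1) ∘ₗ (bgrad c (liftEquiv s ι) ∘ₗ tensorId ι T)) K := by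
  rw [bgrad_liftEquiv_comp, mulOp_fst_comp_tensorId]
  exact hasMaj_tensorId ι hK h

omit [Fintype J] [Fintype X] [Fintype ι] in
/-- ★ **THE PLATEAU IDENTITY LIFTS**: `T∘M_ψ = T` ⟹ `(T ⊗ 1)∘M_{ψ∘fst} = T ⊗ 1`. [folklore] -/
theorem tensorId_comp_mulOp_fst_of {ψ : X → ℝ} {T : (X → ℝ) →ₗ[ℝ] (X → ℝ)} (h : T ∘ₗ mulOp ψ = T) : tensorId ι T ∘ₗ mulOp (fun p : X × ι => ψ p.1) = tensorId ι T := by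
  rw [tensorId_comp_mulOp_fst, h]

omit [Fintype X] [Fintype ι] in
/-- ★ **THE EXACT LOCALITY LIFTS**: `M_h∘(Σ∇*∇ + 0 + N_L)∘G = M_h` ⟹ `M_{h∘fst}∘(Σ∇̂*∇̂ + 0 + N_L ⊗ 1)∘(G ⊗ 1) = M_{h∘fst}`. [cite: Balaban1984PropagatorsII, (2.91) p.239 (mechanism)] -/
theorem mulOp_fst_lapOp_add_tensorId_of (c : ℝ) (e : J → X ≃ X) {h : X → ℝ} {NL G : (X → ℝ) →ₗ[ℝ] (X → ℝ)} (hloc : mulOp h ∘ₗ (lapOp c e 0 + NL) ∘ₗ G = mulOp h) :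
    mulOp (fun p : X × ι => h p.1) ∘ₗ (lapOp c (fun μ => liftEquiv (e μ) ι) 0 + tensorId ι NL) ∘ₗ tensorId ι G = mulOp (fun p : X × ι => h p.1) := by
  rw [lapOp_liftEquiv_eq, ← tensorId_add, tensorId_comp_tensorId, mulOp_fst_comp_tensorId, hloc, tensorId_mulOp]

end Dictionary

/-! ## §2 The cover rows on the coloured carrier -/

section Cover

variable {M : Fin (d + 1) → ℕ} [∀ μ, NeZero (M μ)] {L kk n w q m₀ m₁ S₁ : ℕ} [NeZero n] (ι : Type) [Fintype ι]

/-- ★★ **52's `hcut` AT THE COVER**: `M_{χ_{□₁}∘fst}∘(G(□_k) ⊗ 1) ≤ 1_□1_□·2^{d+1}Ce^{δ₀}·e^{−δd}` for the inner cut box `□₁ = c(m₁,k) + [0,S₁)` inside the cube `□_k = c(m₀,k) + [0,qw)`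
(`m₁ ≤ m₀`, `(m₀ − m₁) + S₁ ≤ qw`), any rate `δ ≤ δ₀` — FILE 117 `hasMaj_chiCube_neumannCubeG_of_gOp` + `hasMaj_chiCube_inner_comp`, lifted.
[cite: Balaban1984PropagatorsII, (2.37) p.229, (2.133) p.247 (shape); Balaban1984PropagatorsI, Prop. 1.2 (1.110) p.35] -/
theorem hasMaj_cut_cover_lift (hM : ∀ ν, M ν = 2 * q * w) (hm : m₁ ≤ m₀) (hfit : (m₀ - m₁) + S₁ ≤ q * w) (hS₀ : q * w ≤ 2 * q * w) {a C δ₀ δ : ℝ} (hC : 0 ≤ C) (hδ₀ : 0 ≤ δ₀) (hδ : δ ≤ δ₀)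
    (hG : HasMaj (BlockNorm.ofBlocks (unitTorusGeo L kk M) (fun b : Tor (fine n M) × Fin (d + 1) => blockOf n M b.1))
      (BlockNorm.ofBlocks (unitTorusGeo L kk M) (fun b : Tor (fine n M) × Fin (d + 1) => blockOf n M b.1)) (gOp M n a) (fun y y' => C * Real.exp (-(δ₀ * tdistT M y y'))))
    (k : Fin (d + 1) → ZMod (2 * q)) :
    HasMaj (BlockNorm.ofBlocks (unitTorusGeo L kk M) (liftBlk (fun b : Tor (fine n M) × Fin (d + 1) => blockOf n M b.1) ι))
      (BlockNorm.ofBlocks (unitTorusGeo L kk M) (liftBlk (fun b : Tor (fine n M) × Fin (d + 1) => blockOf n M b.1) ι))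
      (mulOp (fun p : (Tor (fine n M) × Fin (d + 1)) × ι => chiCube M n (coverCorner M w q m₁ k) S₁ p.1) ∘ₗ tensorId ι (neumannCubeG M n (coverCorner M w q m₀ k) (q * w) a))
      (fun y y' => ind ((cubeBlocks M (coverCorner M w q m₀ k) (q * w) : Finset (Tor M)) : Set (Tor M)) y * ind ((cubeBlocks M (coverCorner M w q m₀ k) (q * w) : Finset (Tor M)) : Set (Tor M)) y' *
        (2 ^ (d + 1) * (C * Real.exp δ₀) * Real.exp (-(δ * (unitTorusGeo L kk M).dist y y')))) := by
  have hM' : ∀ ν, M ν = 2 * (q * w) := fun ν => by rw [hM ν, mul_assoc]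
  have hind : ∀ y y' : Tor M, 0 ≤ ind (g := unitTorusGeo L kk M) ((cubeBlocks M (coverCorner M w q m₀ k) (q * w) : Finset (Tor M)) : Set (Tor M)) y *
      ind (g := unitTorusGeo L kk M) ((cubeBlocks M (coverCorner M w q m₀ k) (q * w) : Finset (Tor M)) : Set (Tor M)) y' := fun y y' => mul_nonneg (ind_nonneg _ _) (ind_nonneg _ _)
  have h0 := hasMaj_rate_le hind (by positivity) hδ (hasMaj_chiCube_neumannCubeG_of_gOp (L := L) (kk := kk) (c₀ := coverCorner M w q m₀ k) (S := q * w) hM' hC hδ₀ hG)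
  exact hasMaj_mulOp_fst_tensorId ι (fun y y' => mul_nonneg (hind y y') (by positivity)) (hasMaj_chiCube_inner_comp hM hm hfit hS₀ k (fun y y' => mul_nonneg (hind y y') (by positivity)) h0)

/-- ★★ **52's `hcutF` AT THE COVER**: `M_{χ_{□₁}∘fst}∘∇̂_μ∘(G(□_k) ⊗ 1) ≤ 1_□1_□·2^{d+1}Ce^{2δ₀}·e^{−δd}` (weight `c = n`, rate `δ ≤ δ₀`) — FILE 117 `hasMaj_chiCube_fgrad_neumannCubeG`, inner cut, lifted.
[cite: Balaban1984PropagatorsII, (2.133) p.247 (shape); Balaban1984PropagatorsI, Prop. 1.2 (1.110) p.35] -/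
theorem hasMaj_cutF_cover_lift (hM : ∀ ν, M ν = 2 * q * w) (hm : m₁ ≤ m₀) (hfit : (m₀ - m₁) + S₁ ≤ q * w) (hS₀ : q * w ≤ 2 * q * w) {a C δ₀ δ : ℝ} (hC : 0 < C) (hδ₀ : 0 < δ₀) (hδ : δ ≤ δ₀)
    {c : ℝ} (hc : c = (n : ℝ)) (μ : Fin (d + 1))
    (hD : HasMaj (BlockNorm.ofBlocks (unitTorusGeo L kk M) (fun b : Tor (fine n M) × Fin (d + 1) => blockOf n M b.1))
      (BlockNorm.ofBlocks (unitTorusGeo L kk M) (fun b : Tor (fine n M) × Fin (d + 1) => blockOf n M b.1))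
      (symbOp M n (sD M n μ (n : ℝ)) ∘ₗ gOp M n a) (fun y y' => C * Real.exp (-(δ₀ * tdistT M y y'))))
    (k : Fin (d + 1) → ZMod (2 * q)) :
    HasMaj (BlockNorm.ofBlocks (unitTorusGeo L kk M) (liftBlk (fun b : Tor (fine n M) × Fin (d + 1) => blockOf n M b.1) ι))
      (BlockNorm.ofBlocks (unitTorusGeo L kk M) (liftBlk (fun b : Tor (fine n M) × Fin (d + 1) => blockOf n M b.1) ι))
      (mulOp (fun p : (Tor (fine n M) × Fin (d + 1)) × ι => chiCube M n (coverCorner M w q m₁ k) S₁ p.1) ∘ₗ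
        (fgrad c (liftEquiv (bshiftEquiv M n μ) ι) ∘ₗ tensorId ι (neumannCubeG M n (coverCorner M w q m₀ k) (q * w) a)))
      (fun y y' => ind ((cubeBlocks M (coverCorner M w q m₀ k) (q * w) : Finset (Tor M)) : Set (Tor M)) y * ind ((cubeBlocks M (coverCorner M w q m₀ k) (q * w) : Finset (Tor M)) : Set (Tor M)) y' *
        (2 ^ (d + 1) * (C * Real.exp δ₀ * Real.exp δ₀) * Real.exp (-(δ * (unitTorusGeo L kk M).dist y y')))) := by
  have hM' : ∀ ν, M ν = 2 * (q * w) := fun ν => by rw [hM ν, mul_assoc]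
  have hind : ∀ y y' : Tor M, 0 ≤ ind (g := unitTorusGeo L kk M) ((cubeBlocks M (coverCorner M w q m₀ k) (q * w) : Finset (Tor M)) : Set (Tor M)) y *
      ind (g := unitTorusGeo L kk M) ((cubeBlocks M (coverCorner M w q m₀ k) (q * w) : Finset (Tor M)) : Set (Tor M)) y' := fun y y' => mul_nonneg (ind_nonneg _ _) (ind_nonneg _ _)
  have h0 := hasMaj_rate_le hind (by positivity) hδ (hasMaj_chiCube_fgrad_neumannCubeG (L := L) (kk := kk) (c₀ := coverCorner M w q m₀ k) (S := q * w) hM' hC hδ₀ μ hc hD)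
  exact hasMaj_mulOp_fst_fgrad_tensorId ι (fun y y' => mul_nonneg (hind y y') (by positivity)) c (bshiftEquiv M n μ)
    (hasMaj_chiCube_inner_comp hM hm hfit hS₀ k (fun y y' => mul_nonneg (hind y y') (by positivity)) h0)

/-- ★★ **52's `hcutB` AT THE COVER**: the backward-gradient cut row, same letter. [cite: Balaban1984PropagatorsII, (2.133) p.247 (shape); Balaban1984PropagatorsI, (1.3) p.18, Prop. 1.2 (1.110) p.35] -/
theorem hasMaj_cutB_cover_lift (hM : ∀ ν, M ν = 2 * q * w) (hm : m₁ ≤ m₀) (hfit : (m₀ - m₁) + S₁ ≤ q * w) (hS₀ : q * w ≤ 2 * q * w) {a C δ₀ δ : ℝ} (hC : 0 < C) (hδ₀ : 0 < δ₀) (hδ : δ ≤ δ₀)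
    {c : ℝ} (hc : c = (n : ℝ)) (μ : Fin (d + 1))
    (hD : HasMaj (BlockNorm.ofBlocks (unitTorusGeo L kk M) (fun b : Tor (fine n M) × Fin (d + 1) => blockOf n M b.1))
      (BlockNorm.ofBlocks (unitTorusGeo L kk M) (fun b : Tor (fine n M) × Fin (d + 1) => blockOf n M b.1))
      (symbOp M n (sD M n μ (n : ℝ)) ∘ₗ gOp M n a) (fun y y' => C * Real.exp (-(δ₀ * tdistT M y y'))))
    (k : Fin (d + 1) → ZMod (2 * q)) :
    HasMaj (BlockNorm.ofBlocks (unitTorusGeo L kk M) (liftBlk (fun b : Tor (fine n M) × Fin (d + 1) => blockOf n M b.1) ι))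
      (BlockNorm.ofBlocks (unitTorusGeo L kk M) (liftBlk (fun b : Tor (fine n M) × Fin (d + 1) => blockOf n M b.1) ι))
      (mulOp (fun p : (Tor (fine n M) × Fin (d + 1)) × ι => chiCube M n (coverCorner M w q m₁ k) S₁ p.1) ∘ₗ
        (bgrad c (liftEquiv (bshiftEquiv M n μ) ι) ∘ₗ tensorId ι (neumannCubeG M n (coverCorner M w q m₀ k) (q * w) a)))
      (fun y y' => ind ((cubeBlocks M (coverCorner M w q m₀ k) (q * w) : Finset (Tor M)) : Set (Tor M)) y * ind ((cubeBlocks M (coverCorner M w q m₀ k) (q * w) : Finset (Tor M)) : Set (Tor M)) y' *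
        (2 ^ (d + 1) * (C * Real.exp δ₀ * Real.exp δ₀) * Real.exp (-(δ * (unitTorusGeo L kk M).dist y y')))) := by
  have hM' : ∀ ν, M ν = 2 * (q * w) := fun ν => by rw [hM ν, mul_assoc]
  have hind : ∀ y y' : Tor M, 0 ≤ ind (g := unitTorusGeo L kk M) ((cubeBlocks M (coverCorner M w q m₀ k) (q * w) : Finset (Tor M)) : Set (Tor M)) y *
      ind (g := unitTorusGeo L kk M) ((cubeBlocks M (coverCorner M w q m₀ k) (q * w) : Finset (Tor M)) : Set (Tor M)) y' := fun y y' => mul_nonneg (ind_nonneg _ _) (ind_nonneg _ _)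
  have h0 := hasMaj_rate_le hind (by positivity) hδ (hasMaj_chiCube_bgrad_neumannCubeG (L := L) (kk := kk) (c₀ := coverCorner M w q m₀ k) (S := q * w) hM' hC.le hδ₀.le μ hc hD)
  exact hasMaj_mulOp_fst_bgrad_tensorId ι (fun y y' => mul_nonneg (hind y y') (by positivity)) c (bshiftEquiv M n μ)
    (hasMaj_chiCube_inner_comp hM hm hfit hS₀ k (fun y y' => mul_nonneg (hind y y') (by positivity)) h0)

omit [Fintype ι] in
/-- ★ **52's `hNψ` AT THE COVER**: `(G(□_k) ⊗ 1)∘M_{χ_{□_k}∘fst} = G(□_k) ⊗ 1`. [cite: Balaban1984PropagatorsII, (2.37) p.229] -/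
theorem cube_comp_psi_cover_lift (hM : ∀ ν, M ν = 2 * q * w) {a : ℝ} (ha : 0 < a) (k : Fin (d + 1) → ZMod (2 * q)) :
    tensorId ι (neumannCubeG M n (coverCorner M w q m₀ k) (q * w) a) ∘ₗ mulOp (fun p : (Tor (fine n M) × Fin (d + 1)) × ι => chiCube M n (coverCorner M w q m₀ k) (q * w) p.1) =
      tensorId ι (neumannCubeG M n (coverCorner M w q m₀ k) (q * w) a) := by
  have hM' : ∀ ν, M ν = 2 * (q * w) := fun ν => by rw [hM ν, mul_assoc]
  exact tensorId_comp_mulOp_fst_of ι (neumannCubeG_comp_mulOp_chiCube (c₀ := coverCorner M w q m₀ k) hM' ha)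

omit [Fintype ι] in
/-- ★★ **52's `hloc0` AT THE COVER**: `M_{h_k∘fst}∘(Σ∇̂*∇̂ + 0 + (aQ*Q − ∂Π∂*) ⊗ 1)∘(G(□_k) ⊗ 1) = M_{h_k∘fst}` (weight `c = n`, window `m₀ + 2w + 1 ≤ qw`). [cite: Balaban1984PropagatorsII, (2.37)–(2.38) p.229, (2.91) p.239] -/
theorem loc0_cover_lift (hM : ∀ ν, M ν = 2 * q * w) (hw : 0 < w) (hfit : m₀ + 2 * w + 1 ≤ q * w) {a : ℝ} (ha : 0 < a) {c : ℝ} (hc : c = (n : ℝ)) (k : Fin (d + 1) → ZMod (2 * q)) :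
    mulOp (fun p : (Tor (fine n M) × Fin (d + 1)) × ι => hcube (2 * q) (coverXi M n w) k p.1) ∘ₗ
        (lapOp c (fun μ => liftEquiv (bshiftEquiv M n μ) ι) 0 + tensorId ι (a • (qvAdjRe M n ∘ₗ qvRe M n) + (-landauRe M n))) ∘ₗ
        tensorId ι (neumannCubeG M n (coverCorner M w q m₀ k) (q * w) a) =
      mulOp (fun p : (Tor (fine n M) × Fin (d + 1)) × ι => hcube (2 * q) (coverXi M n w) k p.1) :=
  mulOp_fst_lapOp_add_tensorId_of ι c (bshiftEquiv M n) (mulOp_coverH_comp_lapOp_add_comp_neumannCubeG hM hw hfit ha hc k)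

/-- ★★★ **52's `hT` AT THE COVER**: the tail row of the dressed smooth-cut cube on the coloured carrier — FILE 117 `hasMaj_tail_cover` lifted through dag-n15-a's `tail_tensorId_eq`; constant
`2^{d+1}(|a|e^{2δ_N} + C₁)e^{−(δ_N−ρ₁)w}·Ce^{δ₀}c_r`, EXPONENTIALLY SMALL IN `w`.
[cite: Balaban1984PropagatorsII, (2.92)–(2.93) p.239, (2.133)–(2.134) p.247, (2.156) p.250; Balaban1985BackgroundPropagators, (3.63)–(3.65) pp.402–403 (mechanism)] -/
theorem hasMaj_tail_cover_lift {S : ℕ} (hM : ∀ ν, M ν = 2 * q * w) (hM2 : ∀ ν, M ν = 2 * S) (hw : 0 < w) (hq : 2 ≤ q) (hfit : m₀ + 2 * w + 1 ≤ S) (hS : S ≤ 2 * q * w)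
    {a C δ₀ C₁ δ₁ δN ρ₁ ρ σ cr : ℝ} (htri : Triangle254 (unitTorusGeo L kk M)) (hrow : RowSum (unitTorusGeo L kk M) σ cr) (hC : 0 ≤ C) (hδ₀ : 0 ≤ δ₀) (hC₁ : 0 ≤ C₁)
    (hδN : 0 ≤ δN) (hδN₁ : δN ≤ δ₁) (hρ₁ : ρ₁ ≤ δN) (hρ : 0 ≤ ρ) (hρδ : ρ ≤ δ₀) (hρσ : ρ + σ ≤ ρ₁)
    (hG : HasMaj (BlockNorm.ofBlocks (unitTorusGeo L kk M) (fun b : Tor (fine n M) × Fin (d + 1) => blockOf n M b.1))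
      (BlockNorm.ofBlocks (unitTorusGeo L kk M) (fun b : Tor (fine n M) × Fin (d + 1) => blockOf n M b.1)) (gOp M n a) (fun y y' => C * Real.exp (-(δ₀ * tdistT M y y'))))
    (hNL : HasMaj (BlockNorm.ofBlocks (unitTorusGeo L kk M) (fun b : Tor (fine n M) × Fin (d + 1) => blockOf n M b.1))
      (BlockNorm.ofBlocks (unitTorusGeo L kk M) (fun b : Tor (fine n M) × Fin (d + 1) => blockOf n M b.1)) (landauRe M n) (fun y y' => C₁ * Real.exp (-(δ₁ * tdistT M y y'))))
    (k : Fin (d + 1) → ZMod (2 * q)) :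
    HasMaj (BlockNorm.ofBlocks (unitTorusGeo L kk M) (liftBlk (fun b : Tor (fine n M) × Fin (d + 1) => blockOf n M b.1) ι))
      (BlockNorm.ofBlocks (unitTorusGeo L kk M) (liftBlk (fun b : Tor (fine n M) × Fin (d + 1) => blockOf n M b.1) ι))
      ((-(mulOp (fun p : (Tor (fine n M) × Fin (d + 1)) × ι => hcube (2 * q) (coverXi M n w) k p.1) ∘ₗ tensorId ι (a • (qvAdjRe M n ∘ₗ qvRe M n) + (-landauRe M n)) ∘ₗ
          mulOp (1 - fun p : (Tor (fine n M) × Fin (d + 1)) × ι => bcube (2 * q) (coverXi M n w) 2 k p.1))) ∘ₗ tensorId ι (neumannCubeG M n (coverCorner M w q m₀ k) S a))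
      (fun y y' => ind ((cubeBlocks M (coverCorner M w q m₀ k) S : Finset (Tor M)) : Set (Tor M)) y * ind ((cubeBlocks M (coverCorner M w q m₀ k) S : Finset (Tor M)) : Set (Tor M)) y' *
        (2 ^ (d + 1) * ((|a| * (Real.exp δN * Real.exp δN) + C₁) * Real.exp (-((δN - ρ₁) * w)) * (C * Real.exp δ₀) * cr) * Real.exp (-(ρ * (unitTorusGeo L kk M).dist y y')))) := by
  have hcr : 0 ≤ cr := hrow.nonneg (coverCorner M w q m₀ k)
  rw [mulOp_one_sub_fst, tail_tensorId_eq]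
  exact hasMaj_tensorId ι (fun y y' => mul_nonneg (mul_nonneg (ind_nonneg _ _) (ind_nonneg _ _)) (by positivity))
    (hasMaj_tail_cover (L := L) (kk := kk) hM hM2 hw hq hfit hS htri hrow hC hδ₀ hC₁ hδN hδN₁ hρ₁ hρ hρδ hρσ hG hNL k)

/-- ★★ **52's `hKN` AT THE COVER**: `[(aQ*Q − ∂Π∂*) ⊗ 1, M_{h_k∘fst}] ≤ ((π(d+1)∕w)(eε)⁻¹ + 2π(d+1)∕w)·(|a|e^{2δ_N} + C₁)·e^{−(δ_N−ε)d}` — FILE 72 `hasMaj_commOp_coverH` on FILE 69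
`hasMaj_nonlocalPart`, lifted by `commOp_tensorId_fst`. [cite: Balaban1984PropagatorsI, (1.69) p.29, (1.126)–(1.128) p.38 (shapes + mechanism)] -/
theorem hasMaj_commOp_nonlocal_cover_lift (hM : ∀ ν, M ν = 2 * q * w) (hw : 0 < w) {a C₁ δ₁ δN ε : ℝ} (hC₁ : 0 ≤ C₁) (hδN : 0 ≤ δN) (hδN₁ : δN ≤ δ₁) (hε : 0 < ε)
    (hNL : HasMaj (BlockNorm.ofBlocks (unitTorusGeo L kk M) (fun b : Tor (fine n M) × Fin (d + 1) => blockOf n M b.1))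
      (BlockNorm.ofBlocks (unitTorusGeo L kk M) (fun b : Tor (fine n M) × Fin (d + 1) => blockOf n M b.1)) (landauRe M n) (fun y y' => C₁ * Real.exp (-(δ₁ * tdistT M y y'))))
    (k : Fin (d + 1) → ZMod (2 * q)) :
    HasMaj (BlockNorm.ofBlocks (unitTorusGeo L kk M) (liftBlk (fun b : Tor (fine n M) × Fin (d + 1) => blockOf n M b.1) ι))
      (BlockNorm.ofBlocks (unitTorusGeo L kk M) (liftBlk (fun b : Tor (fine n M) × Fin (d + 1) => blockOf n M b.1) ι))
      (commOp (tensorId ι (a • (qvAdjRe M n ∘ₗ qvRe M n) + (-landauRe M n))) (fun p : (Tor (fine n M) × Fin (d + 1)) × ι => hcube (2 * q) (coverXi M n w) k p.1))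
      (fun y y' => (π * (d + 1) / w * (Real.exp 1 * ε)⁻¹ + 2 * (π * (d + 1) / w)) * (|a| * (Real.exp δN * Real.exp δN) + C₁) * Real.exp (-((δN - ε) * (unitTorusGeo L kk M).dist y y'))) := by
  rw [commOp_tensorId_fst]
  exact hasMaj_tensorId ι (fun y y' => by positivity) (hasMaj_commOp_coverH (L := L) (kk := kk) hM hw k (by positivity) hε (hasMaj_nonlocalPart (L := L) (kk := kk) hC₁ hδN hδN₁ hNL))

end Cover

end Summit.QuantumFields.YangMills.BalabanUVNodes.N15.Gluing

end
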